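import Summits.BirchSwinnertonDyer.BirchSwinnertonDyer.Theorems.ResidualThetaTransportAtTwoResidualSignedLambdaLowerCMAtTwoChildABOfQuotientFact
import Summits.BirchSwinnertonDyer.BirchSwinnertonDyer.Theorems.ResidualThetaTransportAtTwoResidualSignedLambdaLowerCMAtTwoClosedModPrintChildAB
import HarnessLib

/-!
# RSL_g CLOSED MODULO TWO NAMED LITERATURE FACTS: `LVsq → Kato2004.exists_zetaElement_newform_tatePairing_values_quotient_two → ResidualSignedLambdaLowerCMAtTwo`
# — every other input of line «onepair» a tree theorem; the print node child AB DISCHARGED by the merged port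

Route `ResidualThetaTransportAtTwo` (RTT), crux RSL_g `ResidualSignedLambdaLowerCMAtTwo` (stmt-BirchSwinnertonDyer-22608), line «onepair»; consumer (R≥)ᵖ
`ResidualThetaCountLowerPureAtTwo` (stmt-BirchSwinnertonDyer-26074), line «bt26_lambda» (its `stub_cmLambdaLower` = RSL_g's text). LEAD `bsd-wall-rtt-p2` g21
(`--supports 22608 --as helper`; closes no item). THEOREMS ONLY (no definition, no named fact, no instance, no `sorry`).

* `stub_kzgChildAB_of_quotientFact` — the ROAD-M print node of both skeletons (child B's registered telescope VERBATIM with `∀ (z c′ w q μt), KVC → (ii_fin) ∧ (ii_λ)`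
  turned into `∃ (z c′ w q μt), KVC ∧ (ii_fin) ∧ (ii_λ)`; critic S165/S170 (b)) under the single hypothesis
  `Kato2004.exists_zetaElement_newform_tatePairing_values_quotient_two` (p736193), by `ChildAB.childAB_of_quotientFact` (`…ChildABOfQuotientFact.lean`; the LEAD's twin of w3 g20's p738520 `…StubKzgChildAB.lean`, whose decls live one namespace up — no clash).
* **`residualSignedLambdaLowerCMAtTwo_of_quotientFact : LVsq → quotient fact → RSL_g`** — K0a is the theorem `Kato2004.nonempty_iwasawaH1DataCoeff_newform_holds`,
  the S3″ body comes from the stations (E) p722652 / (DESC) p727151 / (R) p725106 through `KZgGlue.iHalf_of_stations` (p719630) and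
  `ChildAB.katoZetaBody_of_childAB` (p736564) fed with child AB, the supply from the GLUE `stub_onePairSupply` (p723772) over S2 / S1⊕ / EH / S4₂ / S4₀, and the
  composition is `LambdaLowerBoundO.residualSignedLambdaLowerCMAtTwo_of_parts₂` (p708451). After this file RSL_g (and 26074's `stub_cmLambdaLower`) is closed
  modulo exactly TWO Literature `def`s: Ribet's LVsq `ModularForms.cmNewform_gamma0_sq_dvd_level` and the Kato–Burungale–Tian quotient fact — PURE CITE.

HONEST FRAMING: a conditional result (both hypotheses are unproved named facts, XL); the ITEMS 22608 / 26074 stay OPEN until the gate says otherwise;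
24105 HELD; BSD is not proved by any of this. References: [Kato2004Asterisque] Thm. 12.4–12.5 (pp. 221–222), §15.16; [BurungaleTian2026] Thm. 2.6;
[Ribet1977Nebentypus] §4 Thm. (4.5); [Kobayashi2003] Thm. 7.3.
-/

set_option autoImplicit false
-- the Theorems namespace of this sub repeats the summit name by design (D-0017 nested layout)
set_option linter.dupNamespace false

noncomputable section

open scoped Classical TensorProduct

namespace Summit.BirchSwinnertonDyer.BirchSwinnertonDyer.Theorems.OnePair.ChildAB

open Summit.BirchSwinnertonDyer.BirchSwinnertonDyer.Theorems
open Literature.NumberTheory.EllipticCurves Literature.NumberTheory.EllipticCurves.GreenbergSelmer Literature.NumberTheory.Automorphic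
open Literature.NumberTheory.GaloisRepresentations NumberField IsDedekindDomain Field
open Literature.NumberTheory.EllipticCurves GreenbergSelmer GreenbergVatsal2000 Kobayashi2003 ModularForms Rank1Residual Literature.NumberTheory.GaloisRepresentations Literature.NumberTheory.Automorphic IsDedekindDomain NumberField Field Rat.HeightOneSpectrum PowerSeries

set_option maxHeartbeats 1600000 in
/-- **Child AB `stub_kzgChildAB` (ROAD M, critic S170 (b)) — child B's REGISTERED telescope VERBATIM with `∀ (z c′ w q μt), KVC → (ii_fin) ∧ (ii_λ)` turned into
`∃ (z c′ w q μt), KVC ∧ (ii_fin) ∧ (ii_λ)` — from the typed fact `Kato2004.exists_zetaElement_newform_tatePairing_values_quotient_two` BY NAME**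
(`ChildAB.childAB_of_quotientFact`; the idle binders of the registered text are not used). Splice for v3j / v10:
`stub_kzgChildAB := stub_kzgChildAB_of_quotientFact ‹cite›`. [cite: Kato2004Asterisque, Thm. 12.4 (1)(2), Thm. 12.5 (1)(2) (pp. 221–222), §15.16 (p. 265)]
[cite: BurungaleTian2026, Thm. 2.6 (p. 5)] -/
theorem stub_kzgChildAB_of_quotientFact
    (hq : Literature.NumberTheory.EllipticCurves.Kato2004.exists_zetaElement_newform_tatePairing_values_quotient_two) :
    open Literature.NumberTheory.EllipticCurves GreenbergSelmer GreenbergVatsal2000 Kobayashi2003 ModularForms Rank1Residual Literature.NumberTheory.GaloisRepresentations Literature.NumberTheory.Automorphic IsDedekindDomain NumberField Field Rat.HeightOneSpectrum PowerSeries Summit.BirchSwinnertonDyer.BirchSwinnertonDyer.Theorems.OnePair in ∀ (W : WeierstrassCurve ℚ) [W.IsElliptic] [W.IsGloballyMinimal], ¬ W.HasCM → W.analyticRank = 0 → GoodSS W 2 → W.frobeniusTrace 2 = 0 → W.Δ < 0 → ∀ (M : ℕ) [NeZero M] (g : CuspForm (CongruenceSubgroup.Gamma0 M) 2) (ι : coeffField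 g →+* PadicAlgCl 2) (Ω : ℂ), Odd M → IsNewform0 g → IsCMForm (liftToGamma1 M 2 g) → cuspCoeff g 2 = 0 → IsCohomologicalPlusPeriod g ι Ω → (∀ ℓ : ℕ, ℓ.Prime → ¬ ℓ ∣ 2 * M * W.conductorNorm ℤ → ‖embCoeff g ι ℓ - (W.frobeniusTrace ℓ : PadicAlgCl 2)‖ < 1) → ∀ (κ : ZpExtension ℚ 2) (γ : absoluteGaloisGroup ℚ), κ.IsCyclotomic → κ.IsTopGenerator γ → IsCyclotomicVariable 2 γ → ∀ (S₀ : Finset (HeightOneSpectrum (RingOfIntegers ℚ))), (∀ v ∈ S₀, ((2 : ℕ) : RingOfIntegers ℚ) ∉ v.asIdeal) → (∀ v, ¬ W.HasGoodReductionAt v → v ∈ S₀) → (∀ v, natGenerator v ∣ M → v ∈ S₀) → ∀ (Lp Lm : IwasawaAlgebraO (Set.range ι)) (d : ℕ), IsPollackPairK g ι Ω Lp Lm → (∀ k, ‖coeff k (iwasawaOToPowerSeries (Set.range ι) Lm)‖ ≤ ‖coeff d (iwasawaOToPowerSeries (Set.range ι) Lm)‖) → (∀ k < d, ‖coeff k (iwasawaOToPowerSeries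 (Set.range ι) Lm)‖ < ‖coeff d (iwasawaOToPowerSeries (Set.range ι) Lm)‖) → ∀ (n : ℕ) (ρ : FramedGaloisRep ℚ (coeffO (Set.range ι)) 2) (Θ : ∀ v : HeightOneSpectrum (RingOfIntegers ℚ), ((2 : ℕ) : RingOfIntegers ℚ) ∈ v.asIdeal → (CofreeF (Set.range ι) ρ ≃+ (Fin n → ↥(W.geomPrimaryTorsion 2)))), (∀ v, ¬ natGenerator v ∣ 2 * M → ρ.IsUnramifiedAt v ∧ ∃ P : Polynomial (coeffO (Set.range ι)), P.map (padicCoeffIntegers (Set.range ι)).subtype = Polynomial.X ^ 2 - Polynomial.C (embCoeff g ι (natGenerator v)) * Polynomial.X + Polynomial.C ((natGenerator v : ℕ) : PadicAlgCl 2) ∧ ρ.HasFrobCharpolyAt v P) → ∀ (hΘ : ∀ v hv (δ : absoluteGaloisGroup (v.adicCompletion ℚ)) m i, Θ v hv (resGalOfEmb (closureEmb (K := ℚ) (v.adicCompletion ℚ)) δ • m) i = resGalOfEmb (closureEmb (K := ℚ) (v.adicCompletion ℚ)) δ • Θ v hv m i), ∀ (ϖ : (coeffO (Set.range ι))), Irreducible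 ϖ → ∀ (Sg : AddSubgroup (H1Γ (Set.range ι) κ ρ)) [Module (coeffO (Set.range ι)) ↥Sg], (∀ (a : (coeffO (Set.range ι))) (s : ↥Sg), ((a • s : ↥Sg) : H1Γ (Set.range ι) κ ρ) = scalarH1 κ.kerSubgroup (CofreeF (Set.range ι) ρ) a s) → (∀ y : H1Γ (Set.range ι) κ ρ, y ∈ Sg ↔ y ∈ plusSelmerSet (Set.range ι) W κ S₀ n ρ Θ) → (∀ (τ : absoluteGaloisGroup ℚ) (y : H1Γ (Set.range ι) κ ρ), y ∈ Sg → conjH1 κ.kerSubgroup (CofreeF (Set.range ι) ρ) τ y ∈ Sg) → (plusSelmerTorsionSet (Set.range ι) W κ S₀ n ρ Θ ϖ).Finite → ∀ (I : Kato2004.IwasawaH1DataCoeff (FramedGaloisRep.toGaloisRep ρ) 2 κ γ) [Module (coeffO (Set.range ι)) I.H] [IsScalarTower (coeffO (Set.range ι)) (IwasawaAlgebraO (Set.range ι)) I.H], (∀ (a : (coeffO (Set.range ι))) (x : I.H), a • x = (PowerSeries.C a : IwasawaAlgebraO (Set.range ι)) • x) → ∀ (π : OnePairPins (Set.range ι)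 W κ γ S₀ n ρ Θ hΘ I Sg), ∀ (F : π.KatoFrame), ∃ (z : I.H) (c' : Fin n → coeffO (Set.range ι)) (w : ℕ → Fin π.nb → PadicAlgCl 2) (q : PadicAlgCl 2) (μt : IwasawaAlgebraO (Set.range ι)), π.KatoValuedClass g ι Ω F.Φ F.τ z c' w q μt ∧ Module.Finite (FractionRing (coeffO (Set.range ι))) (TensorProduct (coeffO (Set.range ι)) (FractionRing (coeffO (Set.range ι))) (zetaQuot I z)) ∧ lamO (Set.range ι) (zetaQuot I z) ≤ lamO (Set.range ι) (CharacterModule ↥π.Sel₀) + lamO (Set.range ι) (IwasawaAlgebraO (Set.range ι) ⧸ Ideal.span {μt}) := by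
  intro W _ _ hcm hr hss ha hΔ M _ g ι Ω hM hg hcmg ha2 hΩ hcong κ γ hκ hγ hcv S₀ hS₀2 hS₀bad hS₀M Lp Lm d hPP hlam1 hlam2 n ρ Θ hfrob hΘ ϖ hϖ
    Sg _ hSg1 hSg2 hSg3 hfin I _ _ hIC π F
  exact childAB_of_quotientFact g ι Ω π F hq hg hΩ.isPlusPeriod hcmg hM ha2 hfrob hκ hγ hS₀2 hSg2 hSg1

set_option maxHeartbeats 4000000 in
/-- **RSL_g from LVsq and the print node child AB** (K0b-free twin of p727151 / p729510 over the MERGED node): K0a by theorem, S3″ body by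
`ChildAB.katoZetaBody_of_childAB` over the stations, supply by the GLUE. This is the form the skeleton «bt26_lambda» v10 composes
(`stub_cmLambdaLower := residualSignedLambdaLowerCMAtTwo_of_childAB cite.2.1 stub_kzgChildAB`). Conditional; BSD is not proved by this.
[cite: Kato2004Asterisque, Thm. 12.5 (1)(2) (pp. 221–222), §15.16 (p. 265)] [cite: Ribet1977Nebentypus, §4 Thm. (4.5) with §3 Cor. (3.5)] -/
theorem residualSignedLambdaLowerCMAtTwo_of_childAB
    (hLV : Literature.NumberTheory.EllipticCurves.ModularForms.cmNewform_gamma0_sq_dvd_level)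
    (hAB :
    open Literature.NumberTheory.EllipticCurves GreenbergSelmer GreenbergVatsal2000 Kobayashi2003 ModularForms Rank1Residual Literature.NumberTheory.GaloisRepresentations Literature.NumberTheory.Automorphic IsDedekindDomain NumberField Field Rat.HeightOneSpectrum PowerSeries Summit.BirchSwinnertonDyer.BirchSwinnertonDyer.Theorems.OnePair in ∀ (W : WeierstrassCurve ℚ) [W.IsElliptic] [W.IsGloballyMinimal], ¬ W.HasCM → W.analyticRank = 0 → GoodSS W 2 → W.frobeniusTrace 2 = 0 → W.Δ < 0 → ∀ (M : ℕ) [NeZero M] (g : CuspForm (CongruenceSubgroup.Gamma0 M) 2) (ι : coeffField g →+* PadicAlgCl 2) (Ω : ℂ), Odd M → IsNewform0 g → IsCMForm (liftToGamma1 M 2 g) → cuspCoeff g 2 = 0 → IsCohomologicalPlusPeriod g ι Ω → (∀ ℓ : ℕ, ℓ.Prime → ¬ ℓ ∣ 2 * M * W.conductorNorm ℤ → ‖embCoeff g ι ℓ - (W.frobeniusTrace ℓ : PadicAlgCl 2)‖ < 1) → ∀ (κ : ZpExtension ℚ 2) (γ : absoluteGaloisGroup ℚ), κ.IsCyclotomic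 → κ.IsTopGenerator γ → IsCyclotomicVariable 2 γ → ∀ (S₀ : Finset (HeightOneSpectrum (RingOfIntegers ℚ))), (∀ v ∈ S₀, ((2 : ℕ) : RingOfIntegers ℚ) ∉ v.asIdeal) → (∀ v, ¬ W.HasGoodReductionAt v → v ∈ S₀) → (∀ v, natGenerator v ∣ M → v ∈ S₀) → ∀ (Lp Lm : IwasawaAlgebraO (Set.range ι)) (d : ℕ), IsPollackPairK g ι Ω Lp Lm → (∀ k, ‖coeff k (iwasawaOToPowerSeries (Set.range ι) Lm)‖ ≤ ‖coeff d (iwasawaOToPowerSeries (Set.range ι) Lm)‖) → (∀ k < d, ‖coeff k (iwasawaOToPowerSeries (Set.range ι) Lm)‖ < ‖coeff d (iwasawaOToPowerSeries (Set.range ι) Lm)‖) → ∀ (n : ℕ) (ρ : FramedGaloisRep ℚ (coeffO (Set.range ι)) 2) (Θ : ∀ v : HeightOneSpectrum (RingOfIntegers ℚ), ((2 : ℕ) : RingOfIntegers ℚ) ∈ v.asIdeal → (CofreeF (Set.range ι) ρ ≃+ (Fin n → ↥(W.geomPrimaryTorsion 2)))), (∀ v, ¬ natGenerator v ∣ 2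 * M → ρ.IsUnramifiedAt v ∧ ∃ P : Polynomial (coeffO (Set.range ι)), P.map (padicCoeffIntegers (Set.range ι)).subtype = Polynomial.X ^ 2 - Polynomial.C (embCoeff g ι (natGenerator v)) * Polynomial.X + Polynomial.C ((natGenerator v : ℕ) : PadicAlgCl 2) ∧ ρ.HasFrobCharpolyAt v P) → ∀ (hΘ : ∀ v hv (δ : absoluteGaloisGroup (v.adicCompletion ℚ)) m i, Θ v hv (resGalOfEmb (closureEmb (K := ℚ) (v.adicCompletion ℚ)) δ • m) i = resGalOfEmb (closureEmb (K := ℚ) (v.adicCompletion ℚ)) δ • Θ v hv m i), ∀ (ϖ : (coeffO (Set.range ι))), Irreducible ϖ → ∀ (Sg : AddSubgroup (H1Γ (Set.range ι) κ ρ)) [Module (coeffO (Set.range ι)) ↥Sg], (∀ (a : (coeffO (Set.range ι))) (s : ↥Sg), ((a • s : ↥Sg) : H1Γ (Set.range ι) κ ρ) = scalarH1 κ.kerSubgroup (CofreeF (Set.range ι) ρ) a s) → (∀ y : H1Γ (Set.range ι) κ ρ, y ∈ Sg ↔ y ∈ plusSelmerSet (Set.range ι) W κ S₀ n ρ Θ)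 → (∀ (τ : absoluteGaloisGroup ℚ) (y : H1Γ (Set.range ι) κ ρ), y ∈ Sg → conjH1 κ.kerSubgroup (CofreeF (Set.range ι) ρ) τ y ∈ Sg) → (plusSelmerTorsionSet (Set.range ι) W κ S₀ n ρ Θ ϖ).Finite → ∀ (I : Kato2004.IwasawaH1DataCoeff (FramedGaloisRep.toGaloisRep ρ) 2 κ γ) [Module (coeffO (Set.range ι)) I.H] [IsScalarTower (coeffO (Set.range ι)) (IwasawaAlgebraO (Set.range ι)) I.H], (∀ (a : (coeffO (Set.range ι))) (x : I.H), a • x = (PowerSeries.C a : IwasawaAlgebraO (Set.range ι)) • x) → ∀ (π : OnePairPins (Set.range ι) W κ γ S₀ n ρ Θ hΘ I Sg), ∀ (F : π.KatoFrame), ∃ (z : I.H) (c' : Fin n → coeffO (Set.range ι)) (w : ℕ → Fin π.nb → PadicAlgCl 2) (q : PadicAlgCl 2) (μt : IwasawaAlgebraO (Set.range ι)), π.KatoValuedClass g ι Ω F.Φ F.τ z c' w q μt ∧ Module.Finite (FractionRing (coeffO (Set.range ι))) (TensorProduct (coeffO (Set.range ι)) (FractionRing (coeffO (Set.range ι)))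 (zetaQuot I z)) ∧ lamO (Set.range ι) (zetaQuot I z) ≤ lamO (Set.range ι) (CharacterModule ↥π.Sel₀) + lamO (Set.range ι) (IwasawaAlgebraO (Set.range ι) ⧸ Ideal.span {μt})) :
    Summit.BirchSwinnertonDyer.BirchSwinnertonDyer.Theses.ResidualThetaTransportAtTwo.ResidualSignedLambdaLowerCMAtTwo :=
  LambdaLowerBoundO.residualSignedLambdaLowerCMAtTwo_of_parts₂
    Literature.NumberTheory.EllipticCurves.Kato2004.nonempty_iwasawaH1DataCoeff_newform_holds
    (katoZetaBody_of_childAB (KZgGlue.iHalf_of_stations stub_kzgTrivialisation kzg_descent_closed stub_kzgValueRelation) hAB)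
    (stub_onePairSupply hLV stub_localDualAwayTwo stub_reciprocity stub_deepHalfAtTwoStrict stub_deepHalfAwayTwo stub_plusColemanO)

set_option maxHeartbeats 4000000 in
/-- **RSL_g closed modulo two named facts: `LVsq → Kato2004.exists_zetaElement_newform_tatePairing_values_quotient_two → ResidualSignedLambdaLowerCMAtTwo`.**
K0a by theorem; S3″ body from the stations and child AB (`ChildAB.katoZetaBody_of_childAB`); supply from the GLUE `stub_onePairSupply`; composition
`LambdaLowerBoundO.residualSignedLambdaLowerCMAtTwo_of_parts₂`. Conditional result; the item stays OPEN; BSD is not proved by this.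
[cite: Kato2004Asterisque, Thm. 12.5 (1)(2) (pp. 221–222), §15.16 (p. 265)] [cite: BurungaleTian2026, Thm. 2.6 (p. 5)]
[cite: Ribet1977Nebentypus, §4 Thm. (4.5) with §3 Cor. (3.5)] [cite: Kobayashi2003, Thm. 7.3 ((7.21), p. 13)] -/
theorem residualSignedLambdaLowerCMAtTwo_of_quotientFact
    (hLV : Literature.NumberTheory.EllipticCurves.ModularForms.cmNewform_gamma0_sq_dvd_level)
    (hq : Literature.NumberTheory.EllipticCurves.Kato2004.exists_zetaElement_newform_tatePairing_values_quotient_two) :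
    Summit.BirchSwinnertonDyer.BirchSwinnertonDyer.Theses.ResidualThetaTransportAtTwo.ResidualSignedLambdaLowerCMAtTwo :=
  residualSignedLambdaLowerCMAtTwo_of_childAB hLV (stub_kzgChildAB_of_quotientFact hq)

end Summit.BirchSwinnertonDyer.BirchSwinnertonDyer.Theorems.OnePair.ChildAB

end
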